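import Summits.Ventures.CertifiedManyBodySolver.Observables.StiffnessVirtualStationSecantCaps
import HarnessLib

/-!
# Ventures/CertifiedManyBodySolver — Observables/StiffnessObliqueStation.lean

HONEST FRAMING: one-sided certified CEILINGS on the uniform flux stiffness (t–t′ f-sum class) at ANY density, read from TWO certified energy
FLOORS at couplings below the target (any hoppings `s_a, s_b` — «oblique» sources off the `t′ = 0` column are the point) and ONE certified CAP at
the target; every leaf is CONDITIONAL on the rows it names; a ceiling never speaks to the presence of order; not a `T_c` estimate, not a
superconductivity verdict; no number of record. Zero compute, no definition, no claim node, no `sorry`.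

Cell `pub/hubbard-fast` (D-0154 (1)(A) «CERTIFICATE REUSE along parameter paths»), seat `hubbard-fast-reuse-2` g11 (`prover-hubbard-fast-reuse-2-g11-0`),
path family «APEX TRANSPORT», line «OBLIQUE STATION»: the REUSE LEMMA in generic form.

THE POINT. On a torus-limit ground state `ω_P` at the target `P = (t′, U)`, density `n`, write `K₁ = e_{Φ(1,0,0)}(ω_P)`, `K₂ = e_{Φ(0,1,0)}(ω_P)`,
`D = e_{Φ(0,0,1)}(ω_P)`. The stiffness ceiling wants a FLOOR on the f-sum hopping functional `K₁ + 2t′K₂` (`Observables/StiffnessTLKineticTT`). The rows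
available on `ω_P` are linear in `(K₁, K₂, D)`: every certified floor `lo ≤ e(1, s, U′, n)` is a variational row `lo ≤ K₁ + sK₂ + U′D`
(`IsTorusLimitOf.energyDensityTT'_le_meanEnergy_hubbardTTPrime`, ANY hopping `s`, any coupling `U′ ≥ 0`), and a cap at the target is
`K₁ + t′K₂ + U·D ≤ hi` (`IsTorusLimitOf.meanEnergy_hubbardTTPrime_eq_energyDensityTT'`). g9's «VIRTUAL STATION» (`Observables/StiffnessVirtualStation`) is the
vertex {one floor, the cap, one Fermi-sea row}; with TWO floor rows `a = (s_a, U_a, lo_a)`, `b = (s_b, U_b, lo_b)` and the cap the three-variable LP has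
the vertex (§1)

  `K₁ + κK₂ ≥ w_a·lo_a + w_b·lo_b + v·ℓ − y·hi`  whenever  `w_a + w_b + v − y = 1`, `w_a s_a + w_b s_b + vκ₃ − y t′ = κ`, `w_a U_a + w_b U_b = y U`

(`w_a, w_b, v, y ≥ 0`; `v` is an optional Fermi-sea member `ℓ ≤ e(1, κ₃, 0, n)`), read at `κ = 2t′`. For two rows at the SAME coupling `U′ < U` with
`s_a ≤ s* ≤ s_b`, `s* = t′(2 − U′/U)`, the vertex has `v = 0`, `y = U′/(U − U′)`, `w_a + w_b = U/(U − U′)`: the f-sum hopping is reached EXACTLY and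
no Fermi-sea dilution enters (the reason the doped `t′ < 0` columns were out of reach of the t′ = 0-sourced virtual station). Cleared by
`E = (U − U′)(s_b − s_a) > 0`: `W_a = U s_b − t′(2U − U′)`, `W_b = t′(2U − U′) − U s_a`, `Y = U′(s_b − s_a)` — BILINEAR in `(U, t′)` with `Y` constant, so
g9's four-corner box certificate (`box_corner_interp`) words a box under any BILINEAR cap `h₀ + h₁U + h₂t′ + h₃Ut′` (§3). For two rows at different
couplings the cleared weights are still bilinear and `Y = 2t′(U_b − U_a) + U_a s_b − U_b s_a` is affine in `t′`, so a cap affine in `U` keeps the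
certificate bilinear (companion `Observables/StiffnessObliqueStationBoxes.lean`: the two-coupling box theorem).

* §1 `hoppingFloor_of_twoFloors_cap` — the LP vertex on the TARGET class (functional form, any `κ`);
* §2 `ObsStiffnessSeqCeilingAt_of_twoFloors_cap_fermiSea` (master leaf), `…_of_twoFloors_cap` (no Fermi-sea member),
  `…_of_twoFloors_cap_cleared` (point form with the cleared weights `E, W_a, W_b, Y`);
* §3 `ObsStiffnessSeqCeilingAt_on_box_of_obliquePair_bilinearCap` (same coupling `U′`, bilinear cap on the box: 4 + 4 + 4 corner checks);
* §4 `tchordFloor_on_Icc` (the `t′`-chord of two floors at one coupling, affine on a segment) and the bilinear box caps the box theorems consume: `affineCap_on_box_of_cap_above` (a `t′`-affine cap at `U₂ ≥ U_r`, `energyDensityTT'_mono_U`) and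
  `secantCapRight_bilinear_on_box` (g10's `energyDensityTT'_secantCap_right` through a `t′`-affine floor at `U₁` and a `t′`-affine cap at `U₂ ≤ U_l`).

NOT said: nothing here beats an SDP kinetic node AT its own coupling and hopping; the quality is set by `U·(floor slack) + U′·(cap slack)` over `U − U′`
— low, tight source couplings win; above the last certified cap of a density the caller must supply a secant/plane cap; `λ ≠ 0` words are not of this
form; no `T > 0`.

References: T. Koma, H. Tasaki, J. Stat. Phys. 76 (1994) 745, §1 [KomaTasaki1994]; D. J. Scalapino, S. R. White, S.-C. Zhang, PRB 47 (1993) 7995, §II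
[ScalapinoWhiteZhang1993]; E. H. Lieb, M. Loss, Duke Math. J. 71 (1993) 337, §8 Theorem 8.2 [LiebLoss1993]; R. B. Griffiths, J. Math. Phys. 7 (1966)
1215, §II [Griffiths1966].
-/

noncomputable section

namespace Summit.Ventures.CertifiedManyBodySolver.Observables

open Literature.MathematicalPhysics.QuantumLattice
open Literature.MathematicalPhysics.QuantumLattice.ThermodynamicLimit
open Literature.MathematicalPhysics.QuantumFieldTheory
open Literature.Probability.LatticeModels
open Matrix Finset Filter Topology HubbardWave0
open scoped Matrix BigOperators ComplexOrder

/-! ## §1 The LP vertex on the target class: two variational floors, the target cap, an optional Fermi-sea row -/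

section Vertex

variable {t U n : ℝ}

/-- **TWO FLOORS + CAP (+ Fermi-sea row) on the TARGET state.** Target `(t′, U)`, `0 ≤ U`, density `0 ≤ n < 2`; certified floors
`lo_a ≤ e(1, s_a, U_a, n)`, `lo_b ≤ e(1, s_b, U_b, n)` (`U_a, U_b ≥ 0`, any hoppings), a cap `e(1, t′, U, n) ≤ hi`, a free-gas floor
`ℓ ≤ e(1, κ₃, 0, n)`; nonnegative weights with `w_a + w_b + v − y = 1`, `w_a s_a + w_b s_b + vκ₃ − y t′ = κ`, `w_a U_a + w_b U_b = y U`. Then for every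
torus limit `ω` of unit `(rectN n L, S^z = 0)`-sector ground states of `hubbardTorusTT' L 1 t′ U`:
`w_a lo_a + w_b lo_b + vℓ − y·hi ≤ e_{Φ(1,κ,0)}(ω)` — the rows tested on `ω`, the double occupancy cancelled by the third identity.
[cite: KomaTasaki1994, §1] [cite: LiebLoss1993, §8, Theorem 8.2] -/
theorem hoppingFloor_of_twoFloors_cap (hU0 : 0 ≤ U) (hn0 : 0 ≤ n) (hn2 : n < 2)
    {sa Ua loa : ℝ} (hUa0 : 0 ≤ Ua) (hfa : loa ≤ energyDensityTT' 1 sa Ua n)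
    {sb Ub lob : ℝ} (hUb0 : 0 ≤ Ub) (hfb : lob ≤ energyDensityTT' 1 sb Ub n)
    {hi : ℝ} (hcap : energyDensityTT' 1 t U n ≤ hi) {κ₃ ℓ : ℝ} (h₃ : ℓ ≤ energyDensityTT' 1 κ₃ 0 n)
    {wa wb v y κ : ℝ} (hwa : 0 ≤ wa) (hwb : 0 ≤ wb) (hv : 0 ≤ v) (hy : 0 ≤ y)
    (hK₁ : wa + wb + v - y = 1) (hK₂ : wa * sa + wb * sb + v * κ₃ - y * t = κ) (hD : wa * Ua + wb * Ub = y * U) :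
    ∀ (ω : InfVolFermionState 2) (Ls : ℕ → ℕ) (ψ : ∀ L, Fock (Orb (FermionTorus 2 L))),
      Tendsto Ls atTop atTop →
      (∀ j, IsGroundStateInSector (hubbardTorusTT' (Ls j) 1 t U) (rectN n (Ls j)) 0 (ψ (Ls j))) →
      (∀ j, star (ψ (Ls j)) ⬝ᵥ ψ (Ls j) = 1) → ω.IsTorusLimitOf ψ Ls →
      wa * loa + wb * lob + v * ℓ - y * hi ≤ ω.meanEnergy (hubbardTTPrimeFermionInteraction 1 κ 0) 1 := by
  intro ω Ls ψ hLs hψ h1 hω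
  have hN : ∀ j, IsNParticle (rectN n (Ls j)) (ψ (Ls j)) := fun j => ((mem_szSector_iff _ _ _).1 (hψ j).1).1
  -- the two variational rows and the Fermi-sea row, tested on the TARGET state
  have hva := hω.energyDensityTT'_le_meanEnergy_hubbardTTPrime 1 sa hUa0 hn0 hn2 hLs hN h1
  have hvb := hω.energyDensityTT'_le_meanEnergy_hubbardTTPrime 1 sb hUb0 hn0 hn2 hLs hN h1
  have hfs := hω.energyDensityTT'_le_meanEnergy_hubbardTTPrime 1 κ₃ (U := 0) le_rfl hn0 hn2 hLs hN h1
  -- the energy identity at the target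
  have heq := hω.meanEnergy_hubbardTTPrime_eq_energyDensityTT' 1 t hU0 hn0 hn2 hLs hψ h1
  rw [ω.meanEnergy_hubbardTTPrime_eq_coords 1 sa Ua] at hva
  rw [ω.meanEnergy_hubbardTTPrime_eq_coords 1 sb Ub] at hvb
  rw [ω.meanEnergy_hubbardTTPrime_eq_coords 1 κ₃ 0] at hfs
  rw [ω.meanEnergy_hubbardTTPrime_eq_coords 1 t U] at heq
  rw [ω.meanEnergy_hubbardTTPrime_eq_coords 1 κ 0]
  set K₁ := ω.meanEnergy (hubbardTTPrimeFermionInteraction 1 0 0) 1 with eK₁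
  set K₂ := ω.meanEnergy (hubbardTTPrimeFermionInteraction 0 1 0) 1 with eK₂
  set Dd := ω.meanEnergy (hubbardTTPrimeFermionInteraction 0 0 1) 1 with eDd
  have ha' : wa * loa ≤ wa * (1 * K₁ + sa * K₂ + Ua * Dd) := mul_le_mul_of_nonneg_left (hfa.trans hva) hwa
  have hb' : wb * lob ≤ wb * (1 * K₁ + sb * K₂ + Ub * Dd) := mul_le_mul_of_nonneg_left (hfb.trans hvb) hwb
  have hv' : v * ℓ ≤ v * (1 * K₁ + κ₃ * K₂ + 0 * Dd) := mul_le_mul_of_nonneg_left (h₃.trans hfs) hv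
  have hc' : y * (1 * K₁ + t * K₂ + U * Dd) ≤ y * hi :=
    mul_le_mul_of_nonneg_left (heq.le.trans (le_of_eq_of_le rfl hcap)) hy
  have e : 1 * K₁ + κ * K₂ + 0 * Dd =
      wa * (1 * K₁ + sa * K₂ + Ua * Dd) + wb * (1 * K₁ + sb * K₂ + Ub * Dd) + v * (1 * K₁ + κ₃ * K₂ + 0 * Dd)
        - y * (1 * K₁ + t * K₂ + U * Dd) := by
    linear_combination (-K₁) * hK₁ + (-K₂) * hK₂ + (-Dd) * hD
  rw [e]
  linarith

end Vertex

/-! ## §2 The stiffness leaves: functional master, no-Fermi-sea form, cleared point form -/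

section Leaf

variable {t U n : ℝ}

/-- **TWO FLOORS + CAP + FERMI-SEA ROW ⇒ stiffness ceiling (functional master, any density).** With the data of §1 at `κ = 2t′`,
`ObsStiffnessSeqCeilingAt t′ U n c` for every rational `c ≥ −(w_a lo_a + w_b lo_b + vℓ − y·hi)/4` (`Observables/StiffnessTLKineticTT`: the uniform flux
stiffness of the target torus-limit class is at most `−e_{Φ(1,2t′,0)}(ω)/4`). [cite: KomaTasaki1994, §1] [cite: ScalapinoWhiteZhang1993, §II]
[cite: LiebLoss1993, §8, Theorem 8.2] -/
theorem ObsStiffnessSeqCeilingAt_of_twoFloors_cap_fermiSea (hU0 : 0 ≤ U) (hn0 : 0 ≤ n) (hn2 : n < 2)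
    {sa Ua loa : ℝ} (hUa0 : 0 ≤ Ua) (hfa : loa ≤ energyDensityTT' 1 sa Ua n)
    {sb Ub lob : ℝ} (hUb0 : 0 ≤ Ub) (hfb : lob ≤ energyDensityTT' 1 sb Ub n)
    {hi : ℝ} (hcap : energyDensityTT' 1 t U n ≤ hi) {κ₃ ℓ : ℝ} (h₃ : ℓ ≤ energyDensityTT' 1 κ₃ 0 n)
    {wa wb v y : ℝ} (hwa : 0 ≤ wa) (hwb : 0 ≤ wb) (hv : 0 ≤ v) (hy : 0 ≤ y)
    (hK₁ : wa + wb + v - y = 1) (hK₂ : wa * sa + wb * sb + v * κ₃ - y * t = 2 * t) (hD : wa * Ua + wb * Ub = y * U)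
    (c : ℚ) (hc : -(wa * loa + wb * lob + v * ℓ - y * hi) / 4 ≤ ((c : ℚ) : ℝ)) :
    ObsStiffnessSeqCeilingAt t U n c := by
  intro ρs θ₀ _ hθ₀ Ls hLs hst
  refine fluxStiffness_le_of_torusLimitTT'_oddMoment_orbit_certificate_seq t (U := U) (δ := 1 - n) (q := ((c : ℚ) : ℝ)) 0
    Finset.univ Finset.univ_nonempty (by linarith) (by linarith) hθ₀ hLs hst ?_
  intro ω Ms ψ hMs hψ h1 hω
  have hψ' : ∀ j, IsGroundStateInSector (hubbardTorusTT' (Ms j) 1 t U) (rectN n (Ms j)) 0 (ψ (Ms j)) := fun j => by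
    simpa only [sub_sub_cancel] using hψ j
  rw [orbitMean_rotOddMomentLimitFunctionalTT_lam_zero_eq_meanEnergy_twice_tPrime hω.isTranslationInvariant]
  have hfl := hoppingFloor_of_twoFloors_cap (κ := 2 * t) hU0 hn0 hn2 hUa0 hfa hUb0 hfb hcap h₃ hwa hwb hv hy hK₁ hK₂ hD ω Ms ψ hMs hψ' h1 hω
  have hc' : -(wa * loa + wb * lob + v * ℓ - y * hi) / 4 ≤ ((c : ℚ) : ℝ) := hc
  linarith

/-- **TWO FLOORS + CAP ⇒ stiffness ceiling (no Fermi-sea member).** Weights `w_a, w_b, y ≥ 0` with `w_a + w_b − y = 1`,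
`w_a s_a + w_b s_b − y t′ = 2t′`, `w_a U_a + w_b U_b = y U`; then `ObsStiffnessSeqCeilingAt t′ U n c` for every rational
`c ≥ −(w_a lo_a + w_b lo_b − y·hi)/4`. [cite: KomaTasaki1994, §1] [cite: ScalapinoWhiteZhang1993, §II] -/
theorem ObsStiffnessSeqCeilingAt_of_twoFloors_cap (hU0 : 0 ≤ U) (hn0 : 0 ≤ n) (hn2 : n < 2)
    {sa Ua loa : ℝ} (hUa0 : 0 ≤ Ua) (hfa : loa ≤ energyDensityTT' 1 sa Ua n)
    {sb Ub lob : ℝ} (hUb0 : 0 ≤ Ub) (hfb : lob ≤ energyDensityTT' 1 sb Ub n)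
    {hi : ℝ} (hcap : energyDensityTT' 1 t U n ≤ hi)
    {wa wb y : ℝ} (hwa : 0 ≤ wa) (hwb : 0 ≤ wb) (hy : 0 ≤ y)
    (hK₁ : wa + wb - y = 1) (hK₂ : wa * sa + wb * sb - y * t = 2 * t) (hD : wa * Ua + wb * Ub = y * U)
    (c : ℚ) (hc : -(wa * loa + wb * lob - y * hi) / 4 ≤ ((c : ℚ) : ℝ)) :
    ObsStiffnessSeqCeilingAt t U n c := by
  -- the Fermi-sea slot carries weight 0 (its floor is the trivial `e(1,0,0,n) ≤ e(1,0,0,n)`)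
  refine ObsStiffnessSeqCeilingAt_of_twoFloors_cap_fermiSea hU0 hn0 hn2 hUa0 hfa hUb0 hfb hcap (κ₃ := 0)
    (le_refl (energyDensityTT' 1 0 0 n)) hwa hwb le_rfl hy (v := 0) ?_ ?_ hD c ?_
  · linarith
  · linarith
  · simpa using hc

/-- **CLEARED POINT FORM (two floors, one cap).** With `E = U(s_b − s_a) + t′(U_a − U_b) + (U_b s_a − U_a s_b)`, `W_a = U s_b − t′(2U − U_b)`,
`W_b = t′(2U − U_a) − U s_a`, `Y = 2t′(U_b − U_a) + U_a s_b − U_b s_a` (the LP vertex weights times `E`; for `U_a = U_b = U′`: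
`E = (U − U′)(s_b − s_a)`, `Y = U′(s_b − s_a)`): if `E > 0`, `W_a, W_b, Y ≥ 0` and `0 ≤ 4cE + W_a lo_a + W_b lo_b − Y·hi`, then
`ObsStiffnessSeqCeilingAt t′ U n c`. [cite: KomaTasaki1994, §1] [cite: ScalapinoWhiteZhang1993, §II] -/
theorem ObsStiffnessSeqCeilingAt_of_twoFloors_cap_cleared (hU0 : 0 ≤ U) (hn0 : 0 ≤ n) (hn2 : n < 2)
    {sa Ua loa : ℝ} (hUa0 : 0 ≤ Ua) (hfa : loa ≤ energyDensityTT' 1 sa Ua n)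
    {sb Ub lob : ℝ} (hUb0 : 0 ≤ Ub) (hfb : lob ≤ energyDensityTT' 1 sb Ub n)
    {hi : ℝ} (hcap : energyDensityTT' 1 t U n ≤ hi)
    (hE : 0 < U * (sb - sa) + t * (Ua - Ub) + (Ub * sa - Ua * sb))
    (hWa : 0 ≤ U * sb - t * (2 * U - Ub)) (hWb : 0 ≤ t * (2 * U - Ua) - U * sa)
    (hY : 0 ≤ 2 * t * (Ub - Ua) + Ua * sb - Ub * sa) (c : ℚ)
    (hG : 0 ≤ 4 * ((c : ℚ) : ℝ) * (U * (sb - sa) + t * (Ua - Ub) + (Ub * sa - Ua * sb)) +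
      (U * sb - t * (2 * U - Ub)) * loa + (t * (2 * U - Ua) - U * sa) * lob - (2 * t * (Ub - Ua) + Ua * sb - Ub * sa) * hi) :
    ObsStiffnessSeqCeilingAt t U n c := by
  set E := U * (sb - sa) + t * (Ua - Ub) + (Ub * sa - Ua * sb) with hEdef
  set Wa := U * sb - t * (2 * U - Ub) with hWadef
  set Wb := t * (2 * U - Ua) - U * sa with hWbdef
  set Y := 2 * t * (Ub - Ua) + Ua * sb - Ub * sa with hYdef
  have hE' : E ≠ 0 := hE.ne'
  refine ObsStiffnessSeqCeilingAt_of_twoFloors_cap hU0 hn0 hn2 hUa0 hfa hUb0 hfb hcap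
    (wa := Wa / E) (wb := Wb / E) (y := Y / E) (div_nonneg hWa hE.le) (div_nonneg hWb hE.le) (div_nonneg hY hE.le) ?_ ?_ ?_ c ?_
  · rw [← add_div, ← sub_div, div_eq_one_iff_eq hE']
    simp only [hEdef, hWadef, hWbdef, hYdef]; ring
  · rw [div_mul_eq_mul_div, div_mul_eq_mul_div, div_mul_eq_mul_div, ← add_div, ← sub_div, div_eq_iff hE']
    simp only [hEdef, hWadef, hWbdef, hYdef]; ring
  · rw [div_mul_eq_mul_div, div_mul_eq_mul_div, div_mul_eq_mul_div, ← add_div, div_eq_div_iff hE' hE']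
    simp only [hEdef, hWadef, hWbdef, hYdef]; ring
  · have key : Wa / E * loa + Wb / E * lob - Y / E * hi = (Wa * loa + Wb * lob - Y * hi) / E := by
      field_simp
    rw [key]
    have hN : -(4 * ((c : ℚ) : ℝ)) * E ≤ Wa * loa + Wb * lob - Y * hi := by linarith
    have hNE := (le_div_iff₀ hE).2 hN
    linarith

end Leaf

/-! ## §3 BOX WORD — two floors at the SAME coupling `U′`, bilinear cap on the box (four corners each) -/

section BoxSame

variable {n U' sa sb loa lob : ℝ}

/-- **BOX WORD, OBLIQUE PAIR AT ONE COUPLING × BILINEAR CAP.** Floors `lo_a ≤ e(1, s_a, U′, n)`, `lo_b ≤ e(1, s_b, U′, n)` with `0 ≤ U′ < U_a < U_b`,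
`s_a < s_b`, `t_a < t_b`; a cap `e(1, t′, U, n) ≤ h₀ + h₁U + h₂t′ + h₃Ut′` at every point of the box; the bracket `W_a = U s_b − t′(2U − U′) ≥ 0`,
`W_b = t′(2U − U′) − U s_a ≥ 0` at the four corners; and the cleared word inequality
`G(U,t′) = 4c(U − U′)(s_b − s_a) + W_a lo_a + W_b lo_b − U′(s_b − s_a)(h₀ + h₁U + h₂t′ + h₃Ut′) ≥ 0` at the four corners. Then
`ObsStiffnessSeqCeilingAt t′ U n c` on the whole box (`W_a`, `W_b`, `G` are affine in `U` at fixed `t′` and in `t′` at fixed `U`; `box_corner_interp`).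
[cite: KomaTasaki1994, §1] [cite: ScalapinoWhiteZhang1993, §II] -/
theorem ObsStiffnessSeqCeilingAt_on_box_of_obliquePair_bilinearCap (hU'0 : 0 ≤ U') (hn0 : 0 ≤ n) (hn2 : n < 2)
    (hfa : loa ≤ energyDensityTT' 1 sa U' n) (hfb : lob ≤ energyDensityTT' 1 sb U' n) (hs : sa < sb)
    {Ua Ub ta tb h₀ h₁ h₂ h₃ : ℝ} (hUa : U' < Ua) (hab : Ua < Ub) (htab : ta < tb)
    (hcapbox : ∀ U ∈ Set.Icc Ua Ub, ∀ t ∈ Set.Icc ta tb, energyDensityTT' 1 t U n ≤ h₀ + h₁ * U + h₂ * t + h₃ * U * t)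
    (hWa₁ : 0 ≤ Ua * sb - ta * (2 * Ua - U')) (hWa₂ : 0 ≤ Ua * sb - tb * (2 * Ua - U'))
    (hWa₃ : 0 ≤ Ub * sb - ta * (2 * Ub - U')) (hWa₄ : 0 ≤ Ub * sb - tb * (2 * Ub - U'))
    (hWb₁ : 0 ≤ ta * (2 * Ua - U') - Ua * sa) (hWb₂ : 0 ≤ tb * (2 * Ua - U') - Ua * sa)
    (hWb₃ : 0 ≤ ta * (2 * Ub - U') - Ub * sa) (hWb₄ : 0 ≤ tb * (2 * Ub - U') - Ub * sa) (c : ℚ)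
    (hG₁ : 0 ≤ 4 * ((c : ℚ) : ℝ) * ((Ua - U') * (sb - sa)) + (Ua * sb - ta * (2 * Ua - U')) * loa + (ta * (2 * Ua - U') - Ua * sa) * lob
      - U' * (sb - sa) * (h₀ + h₁ * Ua + h₂ * ta + h₃ * Ua * ta))
    (hG₂ : 0 ≤ 4 * ((c : ℚ) : ℝ) * ((Ua - U') * (sb - sa)) + (Ua * sb - tb * (2 * Ua - U')) * loa + (tb * (2 * Ua - U') - Ua * sa) * lob
      - U' * (sb - sa) * (h₀ + h₁ * Ua + h₂ * tb + h₃ * Ua * tb))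
    (hG₃ : 0 ≤ 4 * ((c : ℚ) : ℝ) * ((Ub - U') * (sb - sa)) + (Ub * sb - ta * (2 * Ub - U')) * loa + (ta * (2 * Ub - U') - Ub * sa) * lob
      - U' * (sb - sa) * (h₀ + h₁ * Ub + h₂ * ta + h₃ * Ub * ta))
    (hG₄ : 0 ≤ 4 * ((c : ℚ) : ℝ) * ((Ub - U') * (sb - sa)) + (Ub * sb - tb * (2 * Ub - U')) * loa + (tb * (2 * Ub - U') - Ub * sa) * lob
      - U' * (sb - sa) * (h₀ + h₁ * Ub + h₂ * tb + h₃ * Ub * tb)) :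
    ∀ U ∈ Set.Icc Ua Ub, ∀ t ∈ Set.Icc ta tb, ObsStiffnessSeqCeilingAt t U n c := by
  intro U hU t ht
  have hUlt : U' < U := hUa.trans_le hU.1
  have hU0 : 0 ≤ U := hU'0.trans hUlt.le
  have hpos : 0 < (Ub - Ua) * (tb - ta) := mul_pos (sub_pos.2 hab) (sub_pos.2 htab)
  -- the two bracket conditions interpolate from the corners
  have hWa : 0 ≤ U * sb - t * (2 * U - U') := by
    have h := box_corner_interp hU ht hWa₁ hWa₂ hWa₃ hWa₄
    have key : (Ub - Ua) * (tb - ta) * (U * sb - t * (2 * U - U')) =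
        (Ub - U) * (tb - t) * (Ua * sb - ta * (2 * Ua - U')) + (Ub - U) * (t - ta) * (Ua * sb - tb * (2 * Ua - U')) +
        (U - Ua) * (tb - t) * (Ub * sb - ta * (2 * Ub - U')) + (U - Ua) * (t - ta) * (Ub * sb - tb * (2 * Ub - U')) := by ring
    have hnn : 0 ≤ (Ub - Ua) * (tb - ta) * (U * sb - t * (2 * U - U')) := by rw [key]; exact h
    exact (mul_nonneg_iff_of_pos_left hpos).1 hnn
  have hWb : 0 ≤ t * (2 * U - U') - U * sa := by
    have h := box_corner_interp hU ht hWb₁ hWb₂ hWb₃ hWb₄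
    have key : (Ub - Ua) * (tb - ta) * (t * (2 * U - U') - U * sa) =
        (Ub - U) * (tb - t) * (ta * (2 * Ua - U') - Ua * sa) + (Ub - U) * (t - ta) * (tb * (2 * Ua - U') - Ua * sa) +
        (U - Ua) * (tb - t) * (ta * (2 * Ub - U') - Ub * sa) + (U - Ua) * (t - ta) * (tb * (2 * Ub - U') - Ub * sa) := by ring
    have hnn : 0 ≤ (Ub - Ua) * (tb - ta) * (t * (2 * U - U') - U * sa) := by rw [key]; exact h
    exact (mul_nonneg_iff_of_pos_left hpos).1 hnn
  have hG : 0 ≤ 4 * ((c : ℚ) : ℝ) * ((U - U') * (sb - sa)) + (U * sb - t * (2 * U - U')) * loa + (t * (2 * U - U') - U * sa) * lob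
      - U' * (sb - sa) * (h₀ + h₁ * U + h₂ * t + h₃ * U * t) := by
    have h := box_corner_interp hU ht hG₁ hG₂ hG₃ hG₄
    have key : (Ub - Ua) * (tb - ta) * (4 * ((c : ℚ) : ℝ) * ((U - U') * (sb - sa)) + (U * sb - t * (2 * U - U')) * loa +
        (t * (2 * U - U') - U * sa) * lob - U' * (sb - sa) * (h₀ + h₁ * U + h₂ * t + h₃ * U * t)) =
        (Ub - U) * (tb - t) * (4 * ((c : ℚ) : ℝ) * ((Ua - U') * (sb - sa)) + (Ua * sb - ta * (2 * Ua - U')) * loa +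
          (ta * (2 * Ua - U') - Ua * sa) * lob - U' * (sb - sa) * (h₀ + h₁ * Ua + h₂ * ta + h₃ * Ua * ta)) +
        (Ub - U) * (t - ta) * (4 * ((c : ℚ) : ℝ) * ((Ua - U') * (sb - sa)) + (Ua * sb - tb * (2 * Ua - U')) * loa +
          (tb * (2 * Ua - U') - Ua * sa) * lob - U' * (sb - sa) * (h₀ + h₁ * Ua + h₂ * tb + h₃ * Ua * tb)) +
        (U - Ua) * (tb - t) * (4 * ((c : ℚ) : ℝ) * ((Ub - U') * (sb - sa)) + (Ub * sb - ta * (2 * Ub - U')) * loa +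
          (ta * (2 * Ub - U') - Ub * sa) * lob - U' * (sb - sa) * (h₀ + h₁ * Ub + h₂ * ta + h₃ * Ub * ta)) +
        (U - Ua) * (t - ta) * (4 * ((c : ℚ) : ℝ) * ((Ub - U') * (sb - sa)) + (Ub * sb - tb * (2 * Ub - U')) * loa +
          (tb * (2 * Ub - U') - Ub * sa) * lob - U' * (sb - sa) * (h₀ + h₁ * Ub + h₂ * tb + h₃ * Ub * tb)) := by ring
    have hnn : 0 ≤ (Ub - Ua) * (tb - ta) * (4 * ((c : ℚ) : ℝ) * ((U - U') * (sb - sa)) + (U * sb - t * (2 * U - U')) * loa +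
        (t * (2 * U - U') - U * sa) * lob - U' * (sb - sa) * (h₀ + h₁ * U + h₂ * t + h₃ * U * t)) := by rw [key]; exact h
    exact (mul_nonneg_iff_of_pos_left hpos).1 hnn
  refine ObsStiffnessSeqCeilingAt_of_twoFloors_cap_cleared (sa := sa) (Ua := U') (sb := sb) (Ub := U') hU0 hn0 hn2 hU'0 hfa hU'0 hfb
    (hcapbox U hU t ht) ?_ ?_ ?_ ?_ c ?_
  · have : 0 < (U - U') * (sb - sa) := mul_pos (sub_pos.2 hUlt) (sub_pos.2 hs)
    linarith [show U * (sb - sa) + t * (U' - U') + (U' * sa - U' * sb) = (U - U') * (sb - sa) by ring]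
  · linarith [show U * sb - t * (2 * U - U') = U * sb - t * (2 * U - U') by ring]
  · exact hWb
  · have : 0 ≤ U' * (sb - sa) := mul_nonneg hU'0 (sub_pos.2 hs).le
    linarith [show 2 * t * (U' - U') + U' * sb - U' * sa = U' * (sb - sa) by ring]
  · linarith [show 4 * ((c : ℚ) : ℝ) * (U * (sb - sa) + t * (U' - U') + (U' * sa - U' * sb)) +
      (U * sb - t * (2 * U - U')) * loa + (t * (2 * U - U') - U * sa) * lob - (2 * t * (U' - U') + U' * sb - U' * sa) * (h₀ + h₁ * U + h₂ * t + h₃ * U * t) =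
      4 * ((c : ℚ) : ℝ) * ((U - U') * (sb - sa)) + (U * sb - t * (2 * U - U')) * loa + (t * (2 * U - U') - U * sa) * lob
      - U' * (sb - sa) * (h₀ + h₁ * U + h₂ * t + h₃ * U * t) by ring]

end BoxSame

/-! ## §4 Affine floors and bilinear caps on a box: the `t′`-chord floor on a segment; a `t′`-affine cap transported down the `U`-ray; the RIGHT secant in `U` -/

section Caps

variable {n : ℝ}

/-- **`t′`-chord floor on a segment (any coupling, any density).** Two floors `lo_a ≤ e(1, s_a, U′, n)`, `lo_b ≤ e(1, s_b, U′, n)`, `s_a < s_b`, `0 ≤ U′`: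
on every sub-interval `[t_a, t_b] ⊆ [s_a, s_b]` the chord `f₀ + f₁t′` (`f₁(s_b − s_a) = lo_b − lo_a`, `f₀ = lo_a − f₁s_a`) is a floor on `e(1, t′, U′, n)`
(`concaveOn_energyDensityTT'_tPrime`). [cite: Ruelle1969, §3.3] -/
theorem tchordFloor_on_Icc {n U' sa sb loa lob f₀ f₁ ta tb : ℝ} (hU' : 0 ≤ U') (hn0 : 0 ≤ n) (hn2 : n < 2) (hs : sa < sb)
    (hfa : loa ≤ energyDensityTT' 1 sa U' n) (hfb : lob ≤ energyDensityTT' 1 sb U' n)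
    (hf₁ : f₁ * (sb - sa) = lob - loa) (hf₀ : f₀ = loa - f₁ * sa) (hta : sa ≤ ta) (htb : tb ≤ sb) :
    ∀ t ∈ Set.Icc ta tb, f₀ + f₁ * t ≤ energyDensityTT' 1 t U' n := by
  intro t ht
  have h1 : sa ≤ t := hta.trans ht.1
  have h2 : t ≤ sb := ht.2.trans htb
  have hd : 0 < sb - sa := sub_pos.2 hs
  have hconc := concaveOn_energyDensityTT'_tPrime 1 hU' hn0 hn2
  have ha : (0 : ℝ) ≤ (sb - t) / (sb - sa) := div_nonneg (by linarith) hd.le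
  have hb : (0 : ℝ) ≤ (t - sa) / (sb - sa) := div_nonneg (by linarith) hd.le
  have hab : (sb - t) / (sb - sa) + (t - sa) / (sb - sa) = 1 := by
    rw [← add_div, div_eq_one_iff_eq hd.ne']; ring
  have hc := hconc.2 (Set.mem_univ sa) (Set.mem_univ sb) ha hb hab
  simp only [smul_eq_mul] at hc
  have ht' : (sb - t) / (sb - sa) * sa + (t - sa) / (sb - sa) * sb = t := by
    rw [div_mul_eq_mul_div, div_mul_eq_mul_div, ← add_div, div_eq_iff hd.ne']; ring
  rw [ht'] at hc
  have ha' := mul_le_mul_of_nonneg_left hfa ha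
  have hb' := mul_le_mul_of_nonneg_left hfb hb
  have e : (sb - t) / (sb - sa) * loa + (t - sa) / (sb - sa) * lob = f₀ + f₁ * t := by
    rw [hf₀, div_mul_eq_mul_div, div_mul_eq_mul_div, ← add_div, div_eq_iff hd.ne']
    linear_combination (sa - t) * hf₁
  linarith [e]

/-- **A `t′`-AFFINE CAP AT `U₂` CAPS THE BOX BELOW IT** (`energyDensityTT'_mono_U`): if `e(1, t′, U₂, n) ≤ c₀ + c₁t′` for `t′ ∈ [t_a, t_b]`, then on
`[U_l, U_r] × [t_a, t_b]` with `0 ≤ U_l`, `U_r ≤ U₂`: `e(1, t′, U, n) ≤ c₀ + 0·U + c₁t′ + 0·Ut′` (the bilinear shape of §3). [cite: Griffiths1966, §II] -/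
theorem affineCap_on_box_of_cap_above (hn0 : 0 ≤ n) (hn2 : n < 2) {U₂ c₀ c₁ Ul Ur ta tb : ℝ} (hUl : 0 ≤ Ul) (hUr : Ur ≤ U₂)
    (hcap : ∀ t ∈ Set.Icc ta tb, energyDensityTT' 1 t U₂ n ≤ c₀ + c₁ * t) :
    ∀ U ∈ Set.Icc Ul Ur, ∀ t ∈ Set.Icc ta tb, energyDensityTT' 1 t U n ≤ c₀ + 0 * U + c₁ * t + 0 * U * t := by
  intro U hU t ht
  have hU0 : 0 ≤ U := hUl.trans hU.1
  have hmono := energyDensityTT'_mono_U 1 t hn0 hn2 hU0 (hU.2.trans hUr)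
  have h := hcap t ht
  linarith

/-- **RIGHT SECANT IN `U`, BILINEAR ON A BOX.** `0 ≤ U₁ < U₂ ≤ U_l ≤ U_r`; a `t′`-affine FLOOR `f₀ + f₁t′ ≤ e(1, t′, U₁, n)` and a `t′`-affine CAP
`e(1, t′, U₂, n) ≤ c₀ + c₁t′` on `[t_a, t_b]`. Then on `[U_l, U_r] × [t_a, t_b]`: `e(1, t′, U, n) ≤ h₀ + h₁U + h₂t′ + h₃Ut′` with `h₁(U₂ − U₁) = c₀ − f₀`,
`h₃(U₂ − U₁) = c₁ − f₁`, `h₀ = c₀ − U₂h₁`, `h₂ = c₁ − U₂h₃` — `energyDensityTT'_secantCap_right` (concavity in `U`) at each hopping, written out.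
[cite: Griffiths1966, §II] [cite: KomaTasaki1994, §1] -/
theorem secantCapRight_bilinear_on_box (hn0 : 0 ≤ n) (hn2 : n < 2) {U₁ U₂ f₀ f₁ c₀ c₁ h₀ h₁ h₂ h₃ Ul Ur ta tb : ℝ}
    (hU₁ : 0 ≤ U₁) (h12 : U₁ < U₂) (h2l : U₂ ≤ Ul)
    (hfloor : ∀ t ∈ Set.Icc ta tb, f₀ + f₁ * t ≤ energyDensityTT' 1 t U₁ n)
    (hcap : ∀ t ∈ Set.Icc ta tb, energyDensityTT' 1 t U₂ n ≤ c₀ + c₁ * t)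
    (hh₁ : h₁ * (U₂ - U₁) = c₀ - f₀) (hh₃ : h₃ * (U₂ - U₁) = c₁ - f₁) (hh₀ : h₀ = c₀ - U₂ * h₁) (hh₂ : h₂ = c₁ - U₂ * h₃) :
    ∀ U ∈ Set.Icc Ul Ur, ∀ t ∈ Set.Icc ta tb, energyDensityTT' 1 t U n ≤ h₀ + h₁ * U + h₂ * t + h₃ * U * t := by
  intro U hU t ht
  have hd : 0 < U₂ - U₁ := sub_pos.2 h12
  have hsec := energyDensityTT'_secantCap_right 1 t hn0 hn2 hU₁ h12 (h2l.trans hU.1) (hfloor t ht) (hcap t ht)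
  have e : c₀ + c₁ * t + (c₀ + c₁ * t - (f₀ + f₁ * t)) * (U - U₂) / (U₂ - U₁) = h₀ + h₁ * U + h₂ * t + h₃ * U * t := by
    have hnum : c₀ + c₁ * t - (f₀ + f₁ * t) = (h₁ + h₃ * t) * (U₂ - U₁) := by linear_combination (-1 : ℝ) * hh₁ - t * hh₃
    rw [hnum, mul_assoc, mul_comm (U₂ - U₁), ← mul_assoc, mul_div_cancel_right₀ _ hd.ne', hh₀, hh₂]
    ring
  linarith [e]

end Caps

end Summit.Ventures.CertifiedManyBodySolver.Observables

end
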